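import Literature.AlgebraicGeometry.Motives.NumericalMotivesCohomology
import Mathlib.LinearAlgebra.FiniteDimensional.Basic
import HarnessLib

/-!
# The rank / Euler characteristic of a motive modulo numerical equivalence
# (Jannsen 1992, p. 451: `rk((X, p, m)) = Σ_i dim pHⁱ(X) ≥ 0`; Lemma 1)

Topic `Literature/AlgebraicGeometry/Motives`, namespace
`Literature.AlgebraicGeometry.Motives.WeilCohomology`; sequel of
`Motives/CorrespondenceAlgebraModNumericalSemisimple` (the graded trace
`W.gradedTrace n X T = Σ_{i ≤ 2n} (-1)^i Tr(T | Hⁱ(X))`, which kills the numerically trivial ideal)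
and `Motives/NumericalMotivesCohomology` (`Hⁱ(M) = p'Hⁱ(X)` for an idempotent lift `p'`).

Source. U. Jannsen, *Motives, numerical equivalence, and semi-simplicity*, Invent. Math. **107**
(1992) [Jannsen1992Motives], p. 451: "the computation leading to Lemma 1 easily shows
`rk((X, p, m)) = Σ_{i ≥ 0} dim_Λ pHⁱ(X) ≥ 0` for every motive `(X, p, m)`" (with the modified
commutativity constraint; with the unmodified one the rank is the alternating sum, i.e. the value
of the intersection form `⟨p · ᵗΔ⟩ = Σ_i (-1)^i Tr(p | Hⁱ(X))` of Lemma 1). We record, for the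
tree's abstract Weil cohomology:

* `trace_apply_eq_finrank_range` — for a projector `p'` of `Bⁿ(X × X)_K`, `Tr(p' | Hⁱ(X)) = dim p'Hⁱ(X)`
  (trace of an idempotent = rank; Mathlib `LinearMap.IsProj.trace`).
* `gradedTrace_eq_sum_finrank_range` — **`⟨p' · ᵗΔ⟩ = Σ_i (-1)^i dim p'Hⁱ(X) = χ(M)`**, the Euler
  characteristic of `M = (X, p, 0)`, an integer (`gradedTrace_eq_intCast`).
* `gradedTrace_eq_of_mk_eq`, `eulerChar_eq_of_lift_eq` — **`χ(M)` depends only on the class of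
  `p'` modulo numerical equivalence** (no standard conjecture needed: the graded trace vanishes on
  numerically trivial correspondences), although the individual `dim p'Hⁱ(X)` are only known to be
  independent of the lift under `C(X)` (`finrank_range_eq_of_lift_eq`).
* `sum_finrank_range_eq_zero_iff` — **`rk(M) = Σ_i dim p'Hⁱ(X) = 0` iff `p' = 0`** (positivity of
  the modified rank).
* `gradedTrace_one` — `χ(h(X)) = Σ_i (-1)^i bᵢ(X)`.

## References

* [Jannsen1992Motives] U. Jannsen, Invent. Math. 107 (1992) — Lemma 1 (p. 448), p. 451 (rank formula).
* [Kleiman1968AlgebraicCycles] S. Kleiman (1968) — Prop. 1.3.6 (Lefschetz trace formula).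

## Provenance

Lane `lit-hodgefound` (summit `HodgeConjecture`, Track 2 foundations library, Layer B: motives),
seat `lit-hodgefound-p29` (literature-prover, generation 34, row g34-#11).
-/

universe u v

open CategoryTheory AlgebraicGeometry MonoidalCategory CartesianMonoidalCategory

noncomputable section

namespace Literature.AlgebraicGeometry.Motives

namespace WeilCohomology

variable {k : Type u} [Field k] {K : Type v} [Field K] [CharZero K] (W : WeilCohomology k K)
variable {n : ℕ} {X : SchemeOver k}

/-- **The trace of a projector on `Hⁱ(X)` is the dimension of its image `p'Hⁱ(X)`** (trace of an
idempotent endomorphism = its rank). [cite: Jannsen1992Motives, p. 451 (rank formula)] -/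
theorem trace_apply_eq_finrank_range (hX : IsSmoothProjective n X) {p' : W.homCorrAlgebra n X}
    (hp' : IsIdempotentElem p') (i : ℕ) :
    LinearMap.trace K (W.obj X i) ((p' : Π i : ℕ, Module.End K (W.obj X i)) i) =
      (Module.finrank K (LinearMap.range ((p' : Π i : ℕ, Module.End K (W.obj X i)) i)) : K) := by
  haveI := W.finite_obj hX i
  exact (LinearMap.IsIdempotentElem.isProj_range _ (W.isIdempotentElem_apply hp' i)).trace

/-- **`⟨p' · ᵗΔ⟩ = Σ_{i ≤ 2n} (-1)^i dim p'Hⁱ(X)`: the graded trace of a projector `p'` of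
`Bⁿ(X × X)_K` is the Euler characteristic of the motive it cuts out** (Jannsen's rank formula, signs
from the unmodified commutativity constraint; Lemma 1 for `g = Δ`).
[cite: Jannsen1992Motives, p. 451 (rank formula) and Lemma 1] -/
theorem gradedTrace_eq_sum_finrank_range (hX : IsSmoothProjective n X) {p' : W.homCorrAlgebra n X}
    (hp' : IsIdempotentElem p') :
    W.gradedTrace n X (p' : Π i : ℕ, Module.End K (W.obj X i)) =
      ∑ i ∈ Finset.range (2 * n + 1), (-1 : K) ^ i *
        (Module.finrank K (LinearMap.range ((p' : Π i : ℕ, Module.End K (W.obj X i)) i)) : K) := by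
  rw [W.gradedTrace_apply]
  exact Finset.sum_congr rfl fun i _ ↦ by rw [W.trace_apply_eq_finrank_range hX hp' i]

/-- The graded trace of a projector is the INTEGER `χ = Σ_{i ≤ 2n} (-1)^i dim p'Hⁱ(X)`.
[cite: Jannsen1992Motives, p. 451 (rank formula)] -/
theorem gradedTrace_eq_intCast (hX : IsSmoothProjective n X) {p' : W.homCorrAlgebra n X}
    (hp' : IsIdempotentElem p') :
    W.gradedTrace n X (p' : Π i : ℕ, Module.End K (W.obj X i)) =
      ((∑ i ∈ Finset.range (2 * n + 1), (-1 : ℤ) ^ i *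
        (Module.finrank K (LinearMap.range ((p' : Π i : ℕ, Module.End K (W.obj X i)) i)) : ℤ) :
          ℤ) : K) := by
  rw [W.gradedTrace_eq_sum_finrank_range hX hp']
  simp only [Int.cast_sum, Int.cast_mul, Int.cast_pow, Int.cast_neg, Int.cast_one, Int.cast_natCast]

/-- **The graded trace is well defined modulo numerical equivalence**: correspondences with the
same class in `Aⁿ_num(X × X, K)` have the same graded trace (it vanishes on the numerically trivial
ideal, `gradedTrace_eq_zero_of_mem_numericallyTrivial`). No standard conjecture is needed.
[cite: Jannsen1992Motives, Lemma 1] -/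
theorem gradedTrace_eq_of_mk_eq {f g : W.homCorrAlgebra n X}
    (h : Ideal.Quotient.mk (W.numericallyTrivial n X).asIdeal f =
      Ideal.Quotient.mk (W.numericallyTrivial n X).asIdeal g) :
    W.gradedTrace n X (f : Π i : ℕ, Module.End K (W.obj X i)) =
      W.gradedTrace n X (g : Π i : ℕ, Module.End K (W.obj X i)) := by
  have hfg : f - g ∈ W.numericallyTrivial n X := by
    rw [← TwoSidedIdeal.mem_asIdeal]
    exact Ideal.Quotient.eq.mp h
  have e := W.gradedTrace_eq_zero_of_mem_numericallyTrivial hfg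
  rw [AddSubgroupClass.coe_sub, map_sub, sub_eq_zero] at e
  exact e

/-- **The Euler characteristic `χ(M) = Σ_i (-1)^i dim p'Hⁱ(X)` of a motive `M = (X, p, 0)` modulo
numerical equivalence does not depend on the idempotent lift `p'` of `p`** — unconditionally
(compare `finrank_range_eq_of_lift_eq`, which needs `C(X)` for the individual dimensions).
[cite: Jannsen1992Motives, p. 451 (rank formula) and Lemma 1] -/
theorem eulerChar_eq_of_lift_eq (hX : IsSmoothProjective n X) {p' p'' : W.homCorrAlgebra n X}
    (hp' : IsIdempotentElem p') (hp'' : IsIdempotentElem p'')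
    (h : Ideal.Quotient.mk (W.numericallyTrivial n X).asIdeal p' =
      Ideal.Quotient.mk (W.numericallyTrivial n X).asIdeal p'') :
    ∑ i ∈ Finset.range (2 * n + 1), (-1 : ℤ) ^ i *
        (Module.finrank K (LinearMap.range ((p' : Π i : ℕ, Module.End K (W.obj X i)) i)) : ℤ) =
      ∑ i ∈ Finset.range (2 * n + 1), (-1 : ℤ) ^ i *
        (Module.finrank K (LinearMap.range ((p'' : Π i : ℕ, Module.End K (W.obj X i)) i)) : ℤ) := by
  have e := W.gradedTrace_eq_of_mk_eq h
  rw [W.gradedTrace_eq_intCast hX hp', W.gradedTrace_eq_intCast hX hp''] at e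
  exact_mod_cast e

/-- **Positivity of the (modified) rank: `rk(M) = Σ_{i ≤ 2n} dim p'Hⁱ(X) = 0` iff `p' = 0`** (Jannsen
p. 451, "`rk((X, p, m)) = Σ dim pHⁱ(X) ≥ 0`": a correspondence all of whose images `p'Hⁱ(X)`,
`i ≤ 2 dim X`, vanish is zero, the groups `Hⁱ(X)`, `i > 2 dim X`, being zero).
[cite: Jannsen1992Motives, p. 451 (rank formula)] -/
theorem sum_finrank_range_eq_zero_iff (hX : IsSmoothProjective n X) (p' : W.homCorrAlgebra n X) :
    ∑ i ∈ Finset.range (2 * n + 1),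
        Module.finrank K (LinearMap.range ((p' : Π i : ℕ, Module.End K (W.obj X i)) i)) = 0 ↔
      p' = 0 := by
  haveI := fun i ↦ W.finite_obj hX i
  constructor
  · intro h
    rw [Finset.sum_eq_zero_iff] at h
    apply Subtype.ext
    funext i
    rw [ZeroMemClass.coe_zero, Pi.zero_apply]
    by_cases hi : i ≤ 2 * n
    · have h0 := h i (Finset.mem_range.mpr (by omega))
      rw [finrank_zero_iff_forall_zero] at h0
      exact LinearMap.ext fun x ↦ by
        have := h0 ⟨_, LinearMap.mem_range_self _ x⟩
        exact congrArg Subtype.val this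
    · haveI := W.subsingleton_obj hX (i := i) (by omega)
      exact LinearMap.ext fun x ↦ Subsingleton.elim _ _
  · rintro rfl
    refine Finset.sum_eq_zero fun i _ ↦ ?_
    rw [ZeroMemClass.coe_zero, Pi.zero_apply, LinearMap.range_zero, finrank_bot]

/-- **`χ(h(X)) = Σ_{i ≤ 2n} (-1)^i bᵢ(X)`**: the graded trace of the diagonal (the identity
correspondence) is the Euler characteristic of `X` (Lemma 1 with `f = g = Δ`).
[cite: Jannsen1992Motives, Lemma 1] [cite: Kleiman1968AlgebraicCycles, Prop. 1.3.6] -/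
theorem gradedTrace_one (hX : IsSmoothProjective n X) :
    W.gradedTrace n X 1 =
      ∑ i ∈ Finset.range (2 * n + 1), (-1 : K) ^ i * (Module.finrank K (W.obj X i) : K) := by
  have e := W.gradedTrace_eq_sum_finrank_range hX (p' := 1) IsIdempotentElem.one
  rw [OneMemClass.coe_one] at e
  rw [e]
  refine Finset.sum_congr rfl fun i _ ↦ ?_
  rw [Pi.one_apply, Module.End.one_eq_id, LinearMap.range_id, finrank_top]

end WeilCohomology

end Literature.AlgebraicGeometry.Motives

end
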